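import Summits.CriticalPhenomena.PercolationContinuityZ3.Theorems.PercNearOneGluingAdditiveGluingFamilyVPointwise
import Summits.CriticalPhenomena.PercolationContinuityZ3.Theorems.PercNearOneGluingAdditiveGluingFamilyU
import Summits.CriticalPhenomena.PercolationContinuityZ3.Theorems.PercNearOneGluingAdditiveGluingCrossPtOneTwo
import Summits.CriticalPhenomena.PercolationContinuityZ3.Theorems.PercNearOneGluingAdditiveGluingDiagOne
import Summits.CriticalPhenomena.PercolationContinuityZ3.Theorems.PercNearOneGluingAdditiveGluingDiagAnyTwo
import Summits.CriticalPhenomena.PercolationContinuityZ3.Theorems.PercNearOneGluingAdditiveGluingDiagPtTwo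
import Summits.CriticalPhenomena.PercolationContinuityZ3.Theorems.PercNearOneGluingAdditiveGluingExchangeAvoidMeets
import HarnessLib

/-!
# Family V of the three-relay certificate atlas — generic assembly (lead c7)

`familyV_slack`: for three distinct relays with `τ₃ ≤ τ₁`, `τ₃ ≤ τ₂`, ANY real weights on the ingredients of family V (the union of
the supports of the atlas charts G6, G3, G5 found by LP(φ) set cover: order row; BHK two-cluster atoms in the any / all / point forms;
BHK one-cluster atoms in the any / point forms; Kozma–Nitzan Lemma-3 exchanges a₃→a₂ (plain, off C(o), off C(o) & meets {o,a₁}) and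
a₃→a₁ (on o ∈ C(a₁), off C(o)); definition rows) that satisfy the sign constraints, the product constraints (`c·u ≤ c'·v` for
two-cluster atoms, `e'·v ≤ e·u` for one-cluster atoms), the definition constraints `z'·v = z·u`, and the 43 per-pattern inequalities
of `familyV_pointwise`, certify `μ(o ↔ A ∖ o ↔ b) ≤ μ(a₃ ↮ b)`.
[cite: KozmaNitzan2024, Theorem 2 (§3.1, pp. 8–9), Lemma 3 (p. 7); VandenbergHaggstromKahn2005, Thm. 1.3 (p. 6), Thm. 1.4 (p. 7)]
-/

namespace Summit.CriticalPhenomena.PercolationContinuityZ3.Theorems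

open MeasureTheory Set Literature.Probability.LatticeModels Literature.Probability.Percolation
open scoped Classical

/-- From a product-form BHK one-cluster atom `u·B ≤ v·A` (with `0 ≤ A`, `0 ≤ B ≤ v`) and weights `0 ≤ e`, `e'·v ≤ e·u`:
the weighted gap `e'·B ≤ e·A` (the case `v = 0` forces `B = 0`). [folklore] -/
theorem familyV_diag_gap {v u A B e e' : ℝ} (hv : 0 ≤ v) (hA : 0 ≤ A) (hB : 0 ≤ B) (hBv : B ≤ v)
    (atom : u * B ≤ v * A) (he : 0 ≤ e) (hee : e' * v ≤ e * u) : e' * B ≤ e * A := by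
  rcases hv.eq_or_lt with h | h
  · have hB0 : B = 0 := le_antisymm (h ▸ hBv) hB
    rw [hB0, mul_zero]; exact mul_nonneg he hA
  · have key : v * (e' * B) ≤ v * (e * A) := by
      calc v * (e' * B) = (e' * v) * B := by ring
        _ ≤ (e * u) * B := mul_le_mul_of_nonneg_right hee hB
        _ = e * (u * B) := by ring
        _ ≤ e * (v * A) := mul_le_mul_of_nonneg_left atom he
        _ = v * (e * A) := by ring
    exact le_of_mul_le_mul_left key h

/-- **Family V, generic assembly** (atlas family of the three-relay certificate). [cite: KozmaNitzan2024, Theorem 2 (§3.1, pp. 8–9)] -/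
theorem familyV_slack : ∀ (n : ℕ) (w : Sym2 (Fin n) → unitInterval) (o b a₁ a₂ a₃ : Fin n) (h12 : a₁ ≠ a₂) (h13 : a₁ ≠ a₃) (h23 : a₂ ≠ a₃) (hτ31 : (prodBernoulli w).real (openConn a₃ b) ≤ (prodBernoulli w).real (openConn a₁ b)) (hτ32 : (prodBernoulli w).real (openConn a₃ b) ≤ (prodBernoulli w).real (openConn a₂ b)) (η xall1p xall1 dg1 dg1p xpt2_1p xpt2_1 xany2p xany2 xall2p xall2 xpt2_3p xpt2_3 dg2 dg2p xall3p xall3 dg3 dg3p xpt3_2p xpt3_2 dg12 dg12p dp12_1 dp12_1p x12p x12 x13p x13 dp13_3 dp13_3p dp23_2 dp23_2p t2 t2a t2m th ta z1 z1p z23 z23p z2 z2p z13 z13p z3 z3p z12 z12p : ℝ) (h0_η : 0 ≤ η) (h0_xall1 : 0 ≤ xall1) (h0_xpt2_1 : 0 ≤ xpt2_1) (h0_xany2 : 0 ≤ xany2) (h0_xall2 : 0 ≤ xall2) (h0_xpt2_3 : 0 ≤ xpt2_3) (h0_xall3 : 0 ≤ xall3) (h0_xpt3_2 : 0 ≤ xpt3_2)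 (h0_x12 : 0 ≤ x12) (h0_x13 : 0 ≤ x13) (h0_dg1 : 0 ≤ dg1) (h0_dg2 : 0 ≤ dg2) (h0_dg3 : 0 ≤ dg3) (h0_dg12 : 0 ≤ dg12) (h0_dp12_1 : 0 ≤ dp12_1) (h0_dp13_3 : 0 ≤ dp13_3) (h0_dp23_2 : 0 ≤ dp23_2) (h0_t2 : 0 ≤ t2) (h0_t2a : 0 ≤ t2a) (h0_t2m : 0 ≤ t2m) (h0_th : 0 ≤ th) (h0_ta : 0 ≤ ta) (hx_xall1 : xall1 * (prodBernoulli w).real (((openConn a₁ a₂)ᶜ ∩ (openConn a₁ a₃)ᶜ) ∩ openConn a₁ o) ≤ xall1p * (prodBernoulli w).real ((openConn a₁ a₂)ᶜ ∩ (openConn a₁ a₃)ᶜ)) (hd_dg1 : dg1p * (prodBernoulli w).real ((openConn a₁ a₂)ᶜ ∩ (openConn a₁ a₃)ᶜ) ≤ dg1 * (prodBernoulli w).real (((openConn a₁ a₂)ᶜ ∩ (openConn a₁ a₃)ᶜ) ∩ openConn a₁ o)) (hx_xpt2_1 : xpt2_1 * (prodBernoulli w).real (((openConn a₂ a₁)ᶜ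 ∩ (openConn a₂ a₃)ᶜ) ∩ openConn a₂ o) ≤ xpt2_1p * (prodBernoulli w).real ((openConn a₂ a₁)ᶜ ∩ (openConn a₂ a₃)ᶜ)) (hx_xany2 : xany2 * (prodBernoulli w).real (((openConn a₂ a₁)ᶜ ∩ (openConn a₂ a₃)ᶜ) ∩ openConn a₂ o) ≤ xany2p * (prodBernoulli w).real ((openConn a₂ a₁)ᶜ ∩ (openConn a₂ a₃)ᶜ)) (hx_xall2 : xall2 * (prodBernoulli w).real (((openConn a₂ a₁)ᶜ ∩ (openConn a₂ a₃)ᶜ) ∩ openConn a₂ o) ≤ xall2p * (prodBernoulli w).real ((openConn a₂ a₁)ᶜ ∩ (openConn a₂ a₃)ᶜ)) (hx_xpt2_3 : xpt2_3 * (prodBernoulli w).real (((openConn a₂ a₁)ᶜ ∩ (openConn a₂ a₃)ᶜ) ∩ openConn a₂ o) ≤ xpt2_3p * (prodBernoulli w).real ((openConn a₂ a₁)ᶜ ∩ (openConn a₂ a₃)ᶜ)) (hd_dg2 : dg2p * (prodBernoulli w).real ((openConn a₂ a₁)ᶜ ∩ (openConn a₂ a₃)ᶜ) ≤ dg2 *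 (prodBernoulli w).real (((openConn a₂ a₁)ᶜ ∩ (openConn a₂ a₃)ᶜ) ∩ openConn a₂ o)) (hx_xall3 : xall3 * (prodBernoulli w).real (((openConn a₃ a₁)ᶜ ∩ (openConn a₃ a₂)ᶜ) ∩ openConn a₃ o) ≤ xall3p * (prodBernoulli w).real ((openConn a₃ a₁)ᶜ ∩ (openConn a₃ a₂)ᶜ)) (hd_dg3 : dg3p * (prodBernoulli w).real ((openConn a₃ a₁)ᶜ ∩ (openConn a₃ a₂)ᶜ) ≤ dg3 * (prodBernoulli w).real (((openConn a₃ a₁)ᶜ ∩ (openConn a₃ a₂)ᶜ) ∩ openConn a₃ o)) (hx_xpt3_2 : xpt3_2 * (prodBernoulli w).real (((openConn a₃ a₁)ᶜ ∩ (openConn a₃ a₂)ᶜ) ∩ openConn a₃ o) ≤ xpt3_2p * (prodBernoulli w).real ((openConn a₃ a₁)ᶜ ∩ (openConn a₃ a₂)ᶜ)) (hd_dg12 : dg12p * (prodBernoulli w).real ((openConn a₃ a₁)ᶜ ∩ (openConn a₃ a₂)ᶜ) ≤ dg12 * (prodBernoulli w).real (((openConn a₃ a₁)ᶜ ∩ (openConn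 a₃ a₂)ᶜ) ∩ (openConn a₁ o ∪ openConn a₂ o))) (hd_dp12_1 : dp12_1p * (prodBernoulli w).real ((openConn a₃ a₁)ᶜ ∩ (openConn a₃ a₂)ᶜ) ≤ dp12_1 * (prodBernoulli w).real (((openConn a₃ a₁)ᶜ ∩ (openConn a₃ a₂)ᶜ) ∩ (openConn a₁ o ∪ openConn a₂ o))) (hx_x12 : x12 * (prodBernoulli w).real (((openConn a₃ a₁)ᶜ ∩ (openConn a₃ a₂)ᶜ) ∩ (openConn a₁ o ∪ openConn a₂ o)) ≤ x12p * (prodBernoulli w).real ((openConn a₃ a₁)ᶜ ∩ (openConn a₃ a₂)ᶜ)) (hx_x13 : x13 * (prodBernoulli w).real (((openConn a₂ a₁)ᶜ ∩ (openConn a₂ a₃)ᶜ) ∩ (openConn a₁ o ∪ openConn a₃ o)) ≤ x13p * (prodBernoulli w).real ((openConn a₂ a₁)ᶜ ∩ (openConn a₂ a₃)ᶜ)) (hd_dp13_3 : dp13_3p * (prodBernoulli w).real ((openConn a₂ a₁)ᶜ ∩ (openConn a₂ a₃)ᶜ) ≤ dp13_3 * (prodBernoulli w).real (((openConn a₂ a₁)ᶜ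 ∩ (openConn a₂ a₃)ᶜ) ∩ (openConn a₁ o ∪ openConn a₃ o))) (hd_dp23_2 : dp23_2p * (prodBernoulli w).real ((openConn a₁ a₂)ᶜ ∩ (openConn a₁ a₃)ᶜ) ≤ dp23_2 * (prodBernoulli w).real (((openConn a₁ a₂)ᶜ ∩ (openConn a₁ a₃)ᶜ) ∩ (openConn a₂ o ∪ openConn a₃ o))) (hz_z1 : z1p * (prodBernoulli w).real ((openConn a₁ a₂)ᶜ ∩ (openConn a₁ a₃)ᶜ) = z1 * (prodBernoulli w).real (((openConn a₁ a₂)ᶜ ∩ (openConn a₁ a₃)ᶜ) ∩ openConn a₁ o)) (hz_z23 : z23p * (prodBernoulli w).real ((openConn a₁ a₂)ᶜ ∩ (openConn a₁ a₃)ᶜ) = z23 * (prodBernoulli w).real (((openConn a₁ a₂)ᶜ ∩ (openConn a₁ a₃)ᶜ) ∩ (openConn a₂ o ∪ openConn a₃ o))) (hz_z2 : z2p * (prodBernoulli w).real ((openConn a₂ a₁)ᶜ ∩ (openConn a₂ a₃)ᶜ) = z2 * (prodBernoulli w).real (((openConn a₂ a₁)ᶜ ∩ (openConn a₂ a₃)ᶜ)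 ∩ openConn a₂ o)) (hz_z13 : z13p * (prodBernoulli w).real ((openConn a₂ a₁)ᶜ ∩ (openConn a₂ a₃)ᶜ) = z13 * (prodBernoulli w).real (((openConn a₂ a₁)ᶜ ∩ (openConn a₂ a₃)ᶜ) ∩ (openConn a₁ o ∪ openConn a₃ o))) (hz_z3 : z3p * (prodBernoulli w).real ((openConn a₃ a₁)ᶜ ∩ (openConn a₃ a₂)ᶜ) = z3 * (prodBernoulli w).real (((openConn a₃ a₁)ᶜ ∩ (openConn a₃ a₂)ᶜ) ∩ openConn a₃ o)) (hz_z12 : z12p * (prodBernoulli w).real ((openConn a₃ a₁)ᶜ ∩ (openConn a₃ a₂)ᶜ) = z12 * (prodBernoulli w).real (((openConn a₃ a₁)ᶜ ∩ (openConn a₃ a₂)ᶜ) ∩ (openConn a₁ o ∪ openConn a₂ o))) (hR1 : 0 ≤ 1 - z12p - z13p - z1p - z23p - z2p - z3p) (hR2 : 0 ≤ 1 - z1p - z23p) (hR3 : 0 ≤ 1 - z12p - z3p) (hR4 : 0 ≤ 1 - z13p - z2p) (hR5 : 0 ≤ 1 + dg12p + dg1p + dp12_1p - ta - xany2p - xpt2_1p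 - z12p - z13p - z1p - z23p - z2p - z3p - η) (hR6 : 0 ≤ 1 + dg1p - ta - z1p - z23p - η) (hR7 : 0 ≤ 1 + dg12p + dp12_1p - t2 - t2a - t2m - ta - xall3p - xpt3_2p - z12p - z3p - η) (hR8 : 0 ≤ dp13_3p + t2 + t2a - xall2p - xany2p - xpt2_1p - xpt2_3p - z13p - z2p) (hR9 : 0 ≤ 1 + dg12p + dg2p + dp23_2p - t2 - t2a - x13p - xpt3_2p - z12p - z13p - z1p - z23p - z2p - z3p) (hR10 : 0 ≤ 1 + dg2p - t2 - t2a - x13p - z13p - z2p) (hR11 : 0 ≤ dp23_2p + ta - xall1p - z1p - z23p + η) (hR12 : 0 ≤ dg3p + dp13_3p + t2 + t2a + ta - x12p - xany2p - xpt2_3p - z12p - z13p - z1p - z23p - z2p - z3p + η) (hR13 : 0 ≤ dg3p + t2 + t2a + t2m + ta - x12p - z12p - z3p + η) (hR14 : 0 ≤ 1 - dg1 - dg12 + dg12p + dg1p - dp12_1 + dp12_1p - ta - th - xany2p - xpt2_1p + z1 + z12 - z12p + z13 - z13p - z1p - z23p - z2p - z3p - η) (hR15 : 0 ≤ 1 -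 dg1 + dg1p - ta - th + z1 - z1p - z23p - η) (hR16 : 0 ≤ 1 - dg12 + dg12p - dp12_1 + dp12_1p - t2 - t2a - t2m - ta - th - xall3p - xpt3_2p + z12 - z12p - z3p - η) (hR17 : 0 ≤ -dp13_3 + dp13_3p + t2 - xall2p - xany2p - xpt2_1p - xpt2_3p + z13 - z13p - z2p) (hR18 : 0 ≤ 1 - dg12 + dg12p - dg2 + dg2p - dp23_2 + dp23_2p - t2 - t2a - t2m - x13p - xpt3_2p + z12 - z12p - z13p - z1p + z2 + z23 - z23p - z2p - z3p) (hR19 : 0 ≤ 1 - dg2 + dg2p - t2 - t2a - t2m - x13p - z13p + z2 - z2p) (hR20 : 0 ≤ -dp23_2 + dp23_2p - xall1p - z1p + z23 - z23p + η) (hR21 : 0 ≤ -dg3 + dg3p - dp13_3 + dp13_3p + t2 - x12p - xany2p - xpt2_3p - z12p + z13 - z13p - z1p + z23 - z23p - z2p + z3 - z3p + η) (hR22 : 0 ≤ -dg3 + dg3p + t2 - x12p - z12p + z3 - z3p + η) (hR23 : 0 ≤ z1 + z12 - z12p + z13 - z13p - z1p - z23p - z2p - z3p) (hR24 : 0 ≤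 z1 - z1p - z23p) (hR25 : 0 ≤ -dg12 + dg12p + dg2p + dp23_2p - t2 - t2a + x13 - x13p - xpt3_2p + z1 + z12 - z12p + z13 - z13p - z1p - z23p - z2p - z3p) (hR26 : 0 ≤ -1 + dp23_2p + ta + th + xall1 - xall1p + z1 - z1p - z23p + η) (hR27 : 0 ≤ -1 + dg3p - dp13_3 + dp13_3p + t2 + t2a + ta + th + x12 - x12p - xany2p - xpt2_3p + z1 + z12 - z12p + z13 - z13p - z1p - z23p - z2p - z3p + η) (hR28 : 0 ≤ z12 - z12p - z3p) (hR29 : 0 ≤ -1 + dg3p + t2 + t2a + t2m + ta + th + x12 - x12p + z12 - z12p - z3p + η) (hR30 : 0 ≤ z13 - z13p - z2p) (hR31 : 0 ≤ dg2p - t2 + x13 - x13p + z13 - z13p - z2p) (hR32 : 0 ≤ z12 - z12p - z13p - z1p + z2 + z23 - z23p - z2p - z3p) (hR33 : 0 ≤ -z13p + z2 - z2p) (hR34 : 0 ≤ -dg12 + dg12p + dg1p - dp12_1 + dp12_1p - ta + xany2 - xany2p + xpt2_1 - xpt2_1p + z12 - z12p - z13p - z1p + z2 + z23 - z23p - z2p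 - z3p - η) (hR35 : 0 ≤ -1 + dp13_3p + t2 + t2a + t2m + xall2 - xall2p + xany2 - xany2p + xpt2_1 - xpt2_1p + xpt2_3 - xpt2_3p - z13p + z2 - z2p) (hR36 : 0 ≤ -1 + dg3p + dp13_3p + t2 + t2a + t2m + ta + x12 - x12p + xany2 - xany2p + xpt2_3 - xpt2_3p + z12 - z12p - z13p - z1p + z2 + z23 - z23p - z2p - z3p + η) (hR37 : 0 ≤ -z1p + z23 - z23p) (hR38 : 0 ≤ dg1p - z1p + z23 - z23p - η) (hR39 : 0 ≤ -z12p + z13 - z13p - z1p + z23 - z23p - z2p + z3 - z3p) (hR40 : 0 ≤ -z12p + z3 - z3p) (hR41 : 0 ≤ dg12p + dg1p + dp12_1p - xany2p - xpt2_1p - z12p + z13 - z13p - z1p + z23 - z23p - z2p + z3 - z3p - η) (hR42 : 0 ≤ dg12p + dp12_1p - t2 + xall3 - xall3p + xpt3_2 - xpt3_2p - z12p + z3 - z3p - η) (hR43 : 0 ≤ dg12p + dg2p - dp23_2 + dp23_2p - t2 + x13 - x13p + xpt3_2 - xpt3_2p - z12p + z13 - z13p - z1p + z23 - z23p - z2p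 + z3 - z3p), (prodBernoulli w).real ((openConn o a₁ ∪ openConn o a₂ ∪ openConn o a₃) \ openConn o b) ≤ (prodBernoulli w).real ((openConn a₃ b)ᶜ) := by
  intro n w o b a₁ a₂ a₃ h12 h13 h23 hτ31 hτ32 η xall1p xall1 dg1 dg1p xpt2_1p xpt2_1 xany2p xany2 xall2p xall2 xpt2_3p xpt2_3 dg2 dg2p xall3p xall3 dg3 dg3p xpt3_2p xpt3_2 dg12 dg12p dp12_1 dp12_1p x12p x12 x13p x13 dp13_3 dp13_3p dp23_2 dp23_2p t2 t2a t2m th ta z1 z1p z23 z23p z2 z2p z13 z13p z3 z3p z12 z12p h0_η h0_xall1 h0_xpt2_1 h0_xany2 h0_xall2 h0_xpt2_3 h0_xall3 h0_xpt3_2 h0_x12 h0_x13 h0_dg1 h0_dg2 h0_dg3 h0_dg12 h0_dp12_1 h0_dp13_3 h0_dp23_2 h0_t2 h0_t2a h0_t2m h0_th h0_ta hx_xall1 hd_dg1 hx_xpt2_1 hx_xany2 hx_xall2 hx_xpt2_3 hd_dg2 hx_xall3 hd_dg3 hx_xpt3_2 hd_dg12 hd_dp12_1 hx_x12 hx_x13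 hd_dp13_3 hd_dp23_2 hz_z1 hz_z23 hz_z2 hz_z13 hz_z3 hz_z12 hR1 hR2 hR3 hR4 hR5 hR6 hR7 hR8 hR9 hR10 hR11 hR12 hR13 hR14 hR15 hR16 hR17 hR18 hR19 hR20 hR21 hR22 hR23 hR24 hR25 hR26 hR27 hR28 hR29 hR30 hR31 hR32 hR33 hR34 hR35 hR36 hR37 hR38 hR39 hR40 hR41 hR42 hR43
  have hnn : ∀ s : Set (BondConfig (Fin n)), 0 ≤ (prodBernoulli w).real s := fun _ => measureReal_nonneg
  have hmono : ∀ s t : Set (BondConfig (Fin n)), s ⊆ t → (prodBernoulli w).real s ≤ (prodBernoulli w).real t :=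
    fun s t hst => measureReal_mono hst
  have Xall1 := stub_crossAllOneTwo_c7 n w a₁ a₂ a₃ o b h12 h13
  have gXall1 : xall1 * (prodBernoulli w).real (((openConn a₁ a₂)ᶜ ∩ (openConn a₁ a₃)ᶜ) ∩ (openConn a₁ o ∩ (openConn a₂ b ∩ openConn a₃ b))) ≤ xall1p * (prodBernoulli w).real (((openConn a₁ a₂)ᶜ ∩ (openConn a₁ a₃)ᶜ) ∩ (openConn a₂ b ∩ openConn a₃ b)) :=
    familyU_cross_gap (hnn _) (hnn _) (hmono _ _ (fun ω hω => hω.1)) (hnn _) (hmono _ _ (fun ω hω => hω.1)) Xall1 h0_xall1 hx_xall1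
  have Dg1 := stub_diagOne_c7 n w a₁ a₂ a₃ o b h12 h13
  have gDg1 : dg1p * (prodBernoulli w).real (((openConn a₁ a₂)ᶜ ∩ (openConn a₁ a₃)ᶜ) ∩ openConn a₁ b) ≤ dg1 * (prodBernoulli w).real (((openConn a₁ a₂)ᶜ ∩ (openConn a₁ a₃)ᶜ) ∩ (openConn a₁ o ∩ openConn a₁ b)) :=
    familyV_diag_gap (hnn _) (hnn _) (hnn _) (hmono _ _ (fun ω hω => hω.1)) Dg1 h0_dg1 hd_dg1
  have Xpt2_1 := stub_crossPtOneTwo_c7 n w a₂ a₁ a₃ o b h12.symm h23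
  have gXpt2_1 : xpt2_1 * (prodBernoulli w).real (((openConn a₂ a₁)ᶜ ∩ (openConn a₂ a₃)ᶜ) ∩ (openConn a₂ o ∩ openConn a₁ b)) ≤ xpt2_1p * (prodBernoulli w).real (((openConn a₂ a₁)ᶜ ∩ (openConn a₂ a₃)ᶜ) ∩ openConn a₁ b) :=
    familyU_cross_gap (hnn _) (hnn _) (hmono _ _ (fun ω hω => hω.1)) (hnn _) (hmono _ _ (fun ω hω => hω.1)) Xpt2_1 h0_xpt2_1 hx_xpt2_1
  have Xany2 := stub_crossAnyOneTwo_c7 n w a₂ a₁ a₃ o b h12.symm h23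
  have gXany2 : xany2 * (prodBernoulli w).real (((openConn a₂ a₁)ᶜ ∩ (openConn a₂ a₃)ᶜ) ∩ (openConn a₂ o ∩ (openConn a₁ b ∪ openConn a₃ b))) ≤ xany2p * (prodBernoulli w).real (((openConn a₂ a₁)ᶜ ∩ (openConn a₂ a₃)ᶜ) ∩ (openConn a₁ b ∪ openConn a₃ b)) :=
    familyU_cross_gap (hnn _) (hnn _) (hmono _ _ (fun ω hω => hω.1)) (hnn _) (hmono _ _ (fun ω hω => hω.1)) Xany2 h0_xany2 hx_xany2
  have Xall2 := stub_crossAllOneTwo_c7 n w a₂ a₁ a₃ o b h12.symm h23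
  have gXall2 : xall2 * (prodBernoulli w).real (((openConn a₂ a₁)ᶜ ∩ (openConn a₂ a₃)ᶜ) ∩ (openConn a₂ o ∩ (openConn a₁ b ∩ openConn a₃ b))) ≤ xall2p * (prodBernoulli w).real (((openConn a₂ a₁)ᶜ ∩ (openConn a₂ a₃)ᶜ) ∩ (openConn a₁ b ∩ openConn a₃ b)) :=
    familyU_cross_gap (hnn _) (hnn _) (hmono _ _ (fun ω hω => hω.1)) (hnn _) (hmono _ _ (fun ω hω => hω.1)) Xall2 h0_xall2 hx_xall2
  have Xpt2_3 := stub_crossPtOneTwo_c7 n w a₂ a₃ a₁ o b h23 h12.symm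
  rw [Set.inter_comm ((openConn a₂ a₃)ᶜ) ((openConn a₂ a₁)ᶜ)] at Xpt2_3
  have gXpt2_3 : xpt2_3 * (prodBernoulli w).real (((openConn a₂ a₁)ᶜ ∩ (openConn a₂ a₃)ᶜ) ∩ (openConn a₂ o ∩ openConn a₃ b)) ≤ xpt2_3p * (prodBernoulli w).real (((openConn a₂ a₁)ᶜ ∩ (openConn a₂ a₃)ᶜ) ∩ openConn a₃ b) :=
    familyU_cross_gap (hnn _) (hnn _) (hmono _ _ (fun ω hω => hω.1)) (hnn _) (hmono _ _ (fun ω hω => hω.1)) Xpt2_3 h0_xpt2_3 hx_xpt2_3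
  have Dg2 := stub_diagOne_c7 n w a₂ a₁ a₃ o b h12.symm h23
  have gDg2 : dg2p * (prodBernoulli w).real (((openConn a₂ a₁)ᶜ ∩ (openConn a₂ a₃)ᶜ) ∩ openConn a₂ b) ≤ dg2 * (prodBernoulli w).real (((openConn a₂ a₁)ᶜ ∩ (openConn a₂ a₃)ᶜ) ∩ (openConn a₂ o ∩ openConn a₂ b)) :=
    familyV_diag_gap (hnn _) (hnn _) (hnn _) (hmono _ _ (fun ω hω => hω.1)) Dg2 h0_dg2 hd_dg2
  have Xall3 := stub_crossAllOneTwo_c7 n w a₃ a₁ a₂ o b h13.symm h23.symm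
  have gXall3 : xall3 * (prodBernoulli w).real (((openConn a₃ a₁)ᶜ ∩ (openConn a₃ a₂)ᶜ) ∩ (openConn a₃ o ∩ (openConn a₁ b ∩ openConn a₂ b))) ≤ xall3p * (prodBernoulli w).real (((openConn a₃ a₁)ᶜ ∩ (openConn a₃ a₂)ᶜ) ∩ (openConn a₁ b ∩ openConn a₂ b)) :=
    familyU_cross_gap (hnn _) (hnn _) (hmono _ _ (fun ω hω => hω.1)) (hnn _) (hmono _ _ (fun ω hω => hω.1)) Xall3 h0_xall3 hx_xall3
  have Dg3 := stub_diagOne_c7 n w a₃ a₁ a₂ o b h13.symm h23.symm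
  have gDg3 : dg3p * (prodBernoulli w).real (((openConn a₃ a₁)ᶜ ∩ (openConn a₃ a₂)ᶜ) ∩ openConn a₃ b) ≤ dg3 * (prodBernoulli w).real (((openConn a₃ a₁)ᶜ ∩ (openConn a₃ a₂)ᶜ) ∩ (openConn a₃ o ∩ openConn a₃ b)) :=
    familyV_diag_gap (hnn _) (hnn _) (hnn _) (hmono _ _ (fun ω hω => hω.1)) Dg3 h0_dg3 hd_dg3
  have Xpt3_2 := stub_crossPtOneTwo_c7 n w a₃ a₂ a₁ o b h23.symm h13.symm
  rw [Set.inter_comm ((openConn a₃ a₂)ᶜ) ((openConn a₃ a₁)ᶜ)] at Xpt3_2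
  have gXpt3_2 : xpt3_2 * (prodBernoulli w).real (((openConn a₃ a₁)ᶜ ∩ (openConn a₃ a₂)ᶜ) ∩ (openConn a₃ o ∩ openConn a₂ b)) ≤ xpt3_2p * (prodBernoulli w).real (((openConn a₃ a₁)ᶜ ∩ (openConn a₃ a₂)ᶜ) ∩ openConn a₂ b) :=
    familyU_cross_gap (hnn _) (hnn _) (hmono _ _ (fun ω hω => hω.1)) (hnn _) (hmono _ _ (fun ω hω => hω.1)) Xpt3_2 h0_xpt3_2 hx_xpt3_2
  have Dg12 := stub_diagAnyTwo_c7 n w a₁ a₂ a₃ o b h13 h23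
  rw [knThm2_openConn_comm a₁ a₃, knThm2_openConn_comm a₂ a₃] at Dg12
  have gDg12 : dg12p * (prodBernoulli w).real (((openConn a₃ a₁)ᶜ ∩ (openConn a₃ a₂)ᶜ) ∩ (openConn a₁ b ∪ openConn a₂ b)) ≤ dg12 * (prodBernoulli w).real (((openConn a₃ a₁)ᶜ ∩ (openConn a₃ a₂)ᶜ) ∩ ((openConn a₁ o ∪ openConn a₂ o) ∩ (openConn a₁ b ∪ openConn a₂ b))) :=
    familyV_diag_gap (hnn _) (hnn _) (hnn _) (hmono _ _ (fun ω hω => hω.1)) Dg12 h0_dg12 hd_dg12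
  have Dp12_1 := stub_diagPtTwo_c7 n w a₁ a₂ a₃ o b h13 h23
  rw [knThm2_openConn_comm a₁ a₃, knThm2_openConn_comm a₂ a₃] at Dp12_1
  have gDp12_1 : dp12_1p * (prodBernoulli w).real (((openConn a₃ a₁)ᶜ ∩ (openConn a₃ a₂)ᶜ) ∩ openConn a₁ b) ≤ dp12_1 * (prodBernoulli w).real (((openConn a₃ a₁)ᶜ ∩ (openConn a₃ a₂)ᶜ) ∩ ((openConn a₁ o ∪ openConn a₂ o) ∩ openConn a₁ b)) :=
    familyV_diag_gap (hnn _) (hnn _) (hnn _) (hmono _ _ (fun ω hω => hω.1)) Dp12_1 h0_dp12_1 hd_dp12_1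
  have X12 := stub_crossAnyTwoOne_c7 n w a₁ a₂ a₃ o b h13 h23
  rw [knThm2_openConn_comm a₁ a₃, knThm2_openConn_comm a₂ a₃] at X12
  have gX12 : x12 * (prodBernoulli w).real (((openConn a₃ a₁)ᶜ ∩ (openConn a₃ a₂)ᶜ) ∩ ((openConn a₁ o ∪ openConn a₂ o) ∩ openConn a₃ b)) ≤ x12p * (prodBernoulli w).real (((openConn a₃ a₁)ᶜ ∩ (openConn a₃ a₂)ᶜ) ∩ openConn a₃ b) :=
    familyU_cross_gap (hnn _) (hnn _) (hmono _ _ (fun ω hω => hω.1)) (hnn _) (hmono _ _ (fun ω hω => hω.1)) X12 h0_x12 hx_x12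
  have X13 := stub_crossAnyTwoOne_c7 n w a₁ a₃ a₂ o b h12 h23.symm
  rw [knThm2_openConn_comm a₁ a₂, knThm2_openConn_comm a₃ a₂] at X13
  have gX13 : x13 * (prodBernoulli w).real (((openConn a₂ a₁)ᶜ ∩ (openConn a₂ a₃)ᶜ) ∩ ((openConn a₁ o ∪ openConn a₃ o) ∩ openConn a₂ b)) ≤ x13p * (prodBernoulli w).real (((openConn a₂ a₁)ᶜ ∩ (openConn a₂ a₃)ᶜ) ∩ openConn a₂ b) :=
    familyU_cross_gap (hnn _) (hnn _) (hmono _ _ (fun ω hω => hω.1)) (hnn _) (hmono _ _ (fun ω hω => hω.1)) X13 h0_x13 hx_x13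
  have Dp13_3 := stub_diagPtTwo_c7 n w a₃ a₁ a₂ o b h23.symm h12
  rw [knThm2_openConn_comm a₃ a₂, knThm2_openConn_comm a₁ a₂] at Dp13_3
  rw [Set.inter_comm ((openConn a₂ a₃)ᶜ) ((openConn a₂ a₁)ᶜ), Set.union_comm (openConn a₃ o) (openConn a₁ o)] at Dp13_3
  have gDp13_3 : dp13_3p * (prodBernoulli w).real (((openConn a₂ a₁)ᶜ ∩ (openConn a₂ a₃)ᶜ) ∩ openConn a₃ b) ≤ dp13_3 * (prodBernoulli w).real (((openConn a₂ a₁)ᶜ ∩ (openConn a₂ a₃)ᶜ) ∩ ((openConn a₁ o ∪ openConn a₃ o) ∩ openConn a₃ b)) :=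
    familyV_diag_gap (hnn _) (hnn _) (hnn _) (hmono _ _ (fun ω hω => hω.1)) Dp13_3 h0_dp13_3 hd_dp13_3
  have Dp23_2 := stub_diagPtTwo_c7 n w a₂ a₃ a₁ o b h12.symm h13.symm
  rw [knThm2_openConn_comm a₂ a₁, knThm2_openConn_comm a₃ a₁] at Dp23_2
  have gDp23_2 : dp23_2p * (prodBernoulli w).real (((openConn a₁ a₂)ᶜ ∩ (openConn a₁ a₃)ᶜ) ∩ openConn a₂ b) ≤ dp23_2 * (prodBernoulli w).real (((openConn a₁ a₂)ᶜ ∩ (openConn a₁ a₃)ᶜ) ∩ ((openConn a₂ o ∪ openConn a₃ o) ∩ openConn a₂ b)) :=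
    familyV_diag_gap (hnn _) (hnn _) (hnn _) (hmono _ _ (fun ω hω => hω.1)) Dp23_2 h0_dp23_2 hd_dp23_2
  have T2 := stub_exchangePlain_c7 n w a₃ a₂ b hτ32
  have sT2 : 0 ≤ t2 * ((prodBernoulli w).real (openConn a₂ b ∩ (openConn a₃ a₂)ᶜ) - (prodBernoulli w).real (openConn a₃ b ∩ (openConn a₃ a₂)ᶜ)) := mul_nonneg h0_t2 (by linarith only [T2])
  have T2av := stub_exchangeAvoid_c7 n w a₃ a₂ o b hτ32
  have sT2av : 0 ≤ t2a * ((prodBernoulli w).real ((openConn a₂ b ∩ (openConn a₃ a₂)ᶜ) ∩ (openConn a₃ o)ᶜ) - (prodBernoulli w).real ((openConn a₃ b ∩ (openConn a₃ a₂)ᶜ) ∩ (openConn a₃ o)ᶜ)) := mul_nonneg h0_t2a (by linarith only [T2av])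
  have T2avm := stub_exchangeAvoidMeets_c7 n w a₃ a₂ o b {o, a₁} hτ32
  rw [Finset.set_biUnion_insert, Finset.set_biUnion_singleton] at T2avm
  have sT2avm : 0 ≤ t2m * ((prodBernoulli w).real (((openConn a₂ b ∩ (openConn a₃ a₂)ᶜ) ∩ (openConn a₃ o)ᶜ) ∩ (openConn a₂ o ∪ openConn a₂ a₁)) - (prodBernoulli w).real (((openConn a₃ b ∩ (openConn a₃ a₂)ᶜ) ∩ (openConn a₃ o)ᶜ) ∩ (openConn a₂ o ∪ openConn a₂ a₁))) := mul_nonneg h0_t2m (by linarith only [T2avm])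
  have T1h := stub_exchangeHas_c7 n w a₃ a₁ o b hτ31
  have sT1h : 0 ≤ th * ((prodBernoulli w).real ((openConn a₁ b ∩ (openConn a₃ a₁)ᶜ) ∩ openConn a₁ o) - (prodBernoulli w).real ((openConn a₃ b ∩ (openConn a₃ a₁)ᶜ) ∩ openConn a₁ o)) := mul_nonneg h0_th (by linarith only [T1h])
  have T1a := stub_exchangeAvoid_c7 n w a₃ a₁ o b hτ31
  have sT1a : 0 ≤ ta * ((prodBernoulli w).real ((openConn a₁ b ∩ (openConn a₃ a₁)ᶜ) ∩ (openConn a₃ o)ᶜ) - (prodBernoulli w).real ((openConn a₃ b ∩ (openConn a₃ a₁)ᶜ) ∩ (openConn a₃ o)ᶜ)) := mul_nonneg h0_ta (by linarith only [T1a])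
  have sEta : 0 ≤ η * ((prodBernoulli w).real (openConn a₁ b) - (prodBernoulli w).real (openConn a₃ b)) := mul_nonneg h0_η (by linarith only [hτ31])
  have hpt := fun ω => familyV_pointwise n o b a₁ a₂ a₃ η xall1p xall1 dg1 dg1p xpt2_1p xpt2_1 xany2p xany2 xall2p xall2 xpt2_3p xpt2_3 dg2 dg2p xall3p xall3 dg3 dg3p xpt3_2p xpt3_2 dg12 dg12p dp12_1 dp12_1p x12p x12 x13p x13 dp13_3 dp13_3p dp23_2 dp23_2p t2 t2a t2m th ta z1 z1p z23 z23p z2 z2p z13 z13p z3 z3p z12 z12p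
    hR1 hR2 hR3 hR4 hR5 hR6 hR7 hR8 hR9 hR10 hR11 hR12 hR13 hR14 hR15 hR16 hR17 hR18 hR19 hR20 hR21 hR22 hR23 hR24 hR25 hR26 hR27 hR28 hR29 hR30 hR31 hR32 hR33 hR34 hR35 hR36 hR37 hR38 hR39 hR40 hR41 hR42 hR43 ω
  have hint := stub_lincombIntegral_c7 n w _ hpt
  simp only [List.map_cons, List.map_nil, List.sum_cons, List.sum_nil, add_zero] at hint
  linarith only [hint, gXall1, gDg1, gXpt2_1, gXany2, gXall2, gXpt2_3, gDg2, gXall3, gDg3, gXpt3_2, gDg12, gDp12_1, gX12, gX13, gDp13_3, gDp23_2, sT2, sT2av, sT2avm, sT1h, sT1a, hz_z1, hz_z23, hz_z2, hz_z13, hz_z3, hz_z12, sEta]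

end Summit.CriticalPhenomena.PercolationContinuityZ3.Theorems
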